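import Summits.BirchSwinnertonDyer.Rank1Residual.X11a.SelmerCompanionNonsplit
import HarnessLib

/-!
# Route (3e) SELMER COMPANION, V: the count over `ℚ` with four kinds of places, and shape A with
# kind (iv) (class X11a = N7; cell `b2b-bsdres`, unit `b2b-bsdres-x11a`, gen 26)

HONEST FRAMING (run/shared/lean/b2b/bsd-rank1-residual/, verbatim in every file): the goal of the
cell is to DELETE the COMBINATION-SHAPED residual classes of the Birch–Swinnerton-Dyer formula for
ALL analytic-rank `≤ 1` elliptic curves over `ℚ` — "full BSD formula for every rank `≤ 1` curve in
class `C`" assembled STRICTLY from published theorems — so that the rank-`≤ 1` remainder becomes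
exactly the CONSTRUCTION-SHAPED classes, which are TYPED (missing-input `Prop`s), NOT attempted.
This is not "finishing BSD". CLASS-OWNERS.md: research routes; NO CLAIM BEYOND STATED CLASSES.
THEOREMS ONLY; nothing booked; no label moves. CONDITIONAL on the PUBLISHED binders GZK (`hGZK`),
Cassels–Tate (`hCT`) and Tate uniformisation (`hU` = A40, `hU2` = A41), and on the per-pair finite
data named.

`natCard_selmerGroup_le_of_congr_of_places_rat`: file I's count over `ℚ` with the kinds (i) `v ∤ p`,
`E(ℚ_v)[p] = 0`; (ii) both split multiplicative, `#A(ℚ_v)[p] ≤ p`; (iii) both multiplicative of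
the same twist type, `μ_p(ℚ_v) = 1`; and the NEW kind (iv) of file IV: `v` the place of an odd prime
`ℓ ≠ p` with `E` non-split multiplicative (`γ(E)` not a square in `ℚ_ℓ`) and `A` good.
`bsdp_of_bsdp_partner_of_selmerCompanion_lossy_at_p_of_kinds`: shape A of file III
(`BSD(A,p) ⟹ BSD(E,p)`, the place of `p` the only lossy one, rank-`0` closed partner) with kinds
(i)–(iv) away from `p` — by the census (`HOME/b2b-bsdres-x11a/g26/SELMER-COMPANION-CENSUS.md` §5)
this moves the `p = 3` reach of route (3e) on N7 from 28 to 53 residue cells (measured; to be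
re-run by the successor with the (iv) column).

References: files I–IV; [MazurRubin2004] §2.3; [SilvermanATAEC1994] Ch. V; [GrossLMS1991] (7.1);
[Miller2011LMS] Def. 1.1; HOME/b2b-bsdres-x11a/REPORT-g26.md.
-/

set_option autoImplicit false

noncomputable section

open scoped Classical NNReal

open WeierstrassCurve Literature.NumberTheory.EllipticCurves
  Literature.NumberTheory.GaloisRepresentations Field NumberField IsDedekindDomain
  Literature.NumberTheory.EllipticCurves.Rank1Residual
  Literature.NumberTheory.EllipticCurves.Rank1Residual.Typed

namespace Summit.BirchSwinnertonDyer.Rank1Residual.X11a.SelmerCompanion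

section Rat

variable (W A : WeierstrassCurve ℚ) [W.IsElliptic] [W.IsGloballyMinimal] [A.IsElliptic]
  (p : ℕ) [hp : Fact p.Prime]

/-- **The count over `ℚ` with FOUR kinds of places** (file I's `natCard_selmerGroup_le_of_congr_of_places`
plus kind (iv)): for `θ : E[p] ≃ A[p]` (`E = W'` globally minimal, `A = W`), `p` odd, `T ⊆ S` as there,
and every `v ∈ S \ T` of kind (i) `v ∤ p ∧ E(ℚ_v)[p] = 0`, (ii) both split multiplicative with
`#A(ℚ_v)[p] ≤ p`, (iii) both multiplicative of the same twist type with `μ_p(ℚ_v) = 1`, or (iv) `v` the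
place of an odd prime `ℓ ≠ p` with `E` non-split multiplicative and `A` good at `ℓ`:
`#Sel^(p)(E/ℚ) ≤ #Sel^(p)(A/ℚ) · ∏_{v ∈ T} #E(ℚ_v)[p] · #(ℤ_v/p)`.
[cite: MazurRubin2004, §2.3] [cite: SilvermanATAEC1994, Ch. V Thm. 3.1, Lemma 5.2, Thm. 5.3, Cor. 5.4] -/
theorem natCard_selmerGroup_le_of_congr_of_places_rat
    (hU : Silverman1994_thmV53_tateUniformisation.{0})
    (hU2 : Silverman1994_thmV53_corV54_tateUniformisation.{0}) (hp2 : p ≠ 2)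
    (θ : geomTorsion W (p : ℤ) ≃+ geomTorsion A (p : ℤ))
    (hθ : ∀ (σ : absoluteGaloisGroup ℚ) (P : geomTorsion W (p : ℤ)), θ (σ • P) = σ • θ P)
    (S T : Finset (HeightOneSpectrum (𝓞 ℚ))) (hTS : T ⊆ S)
    (hS : ∀ v : HeightOneSpectrum (𝓞 ℚ), v ∉ S →
      A.HasGoodReductionAt v ∧ W.HasGoodReductionAt v ∧ (p : 𝓞 ℚ) ∉ v.asIdeal)
    (hplaces : ∀ v ∈ S, v ∉ T →
      ((p : 𝓞 ℚ) ∉ v.asIdeal ∧ Nat.card (nsmulAddMonoidHom p :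
          (W.baseChange (v.adicCompletion ℚ)).toAffine.Point →+ _).ker = 1) ∨
      (A.HasSplitMultiplicativeReductionAt v ∧ W.HasSplitMultiplicativeReductionAt v ∧
        Nat.card (nsmulAddMonoidHom p :
          (A.baseChange (v.adicCompletion ℚ)).toAffine.Point →+ _).ker ≤ p) ∨
      (A.HasMultiplicativeReductionAt v ∧ W.HasMultiplicativeReductionAt v ∧
        (∃ r : v.adicCompletion ℚ, algebraMap ℚ (v.adicCompletion ℚ) (-(A.c₄ / A.c₆)) =
          r ^ 2 * algebraMap ℚ (v.adicCompletion ℚ) (-(W.c₄ / W.c₆))) ∧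
        (∀ ζ : v.adicCompletion ℚ, ζ ^ p = 1 → ζ = 1)) ∨
      (∃ (ℓ : ℕ) (_ : Fact ℓ.Prime), ℓ ≠ 2 ∧ (ℓ : 𝓞 ℚ) ∈ v.asIdeal ∧ (p : 𝓞 ℚ) ∉ v.asIdeal ∧
        W.HasMultiplicativeReductionAtPrime ℓ ∧
        (∀ r : v.adicCompletion ℚ, algebraMap ℚ (v.adicCompletion ℚ) (-(W.c₄ / W.c₆)) ≠ r ^ 2) ∧
        A.HasGoodReductionAt v)) :
    Nat.card (W.selmerGroup (p : ℤ)) ≤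
      Nat.card (A.selmerGroup (p : ℤ)) *
        ∏ v ∈ T, (Nat.card (nsmulAddMonoidHom p :
            (W.baseChange (v.adicCompletion ℚ)).toAffine.Point →+ _).ker *
          Nat.card (v.adicCompletionIntegers ℚ ⧸
            Ideal.span {(p : v.adicCompletionIntegers ℚ)})) := by
  have hpp : p.Prime := hp.out
  classical
  -- enlarge `T` by the places of kind (i)
  set T' := T ∪ S.filter (fun v ↦ (p : 𝓞 ℚ) ∉ v.asIdeal ∧ Nat.card (nsmulAddMonoidHom p :
      (W.baseChange (v.adicCompletion ℚ)).toAffine.Point →+ _).ker = 1) with hT'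
  have hT'S : T' ⊆ S := Finset.union_subset hTS (Finset.filter_subset _ _)
  have h1 := natCard_selmerGroup_le_of_congr_of_le_off A W hp2 θ hθ S T' hT'S hS
    (fun v hv hvT c hc ↦ ?_)
  · refine h1.trans (Nat.mul_le_mul_left _ (le_of_eq ?_))
    have hsplit : T' = T ∪ (S.filter (fun v ↦ (p : 𝓞 ℚ) ∉ v.asIdeal ∧ Nat.card (nsmulAddMonoidHom p :
      (W.baseChange (v.adicCompletion ℚ)).toAffine.Point →+ _).ker = 1) \ T) := by
      rw [hT', Finset.union_sdiff_self_eq_union]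
    rw [hsplit, Finset.prod_union Finset.disjoint_sdiff,
      Finset.prod_eq_one (s := _ \ T) (fun v hv ↦ ?_), mul_one]
    · refine Finset.prod_congr rfl fun v _ ↦ ?_
      exact W.natCard_kummerLocalConditionAt_adicCompletion v hpp.ne_zero
    · rw [Finset.mem_sdiff, Finset.mem_filter] at hv
      rw [W.natCard_kummerLocalConditionAt_adicCompletion v hpp.ne_zero, hv.1.2.2, one_mul,
        natCard_quot_adicCompletionIntegers_eq_one hv.1.2.1]
  · have hvT0 : v ∉ T := fun h ↦ hvT (Finset.mem_union_left _ h)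
    have hnot1 : ¬ ((p : 𝓞 ℚ) ∉ v.asIdeal ∧ Nat.card (nsmulAddMonoidHom p :
        (W.baseChange (v.adicCompletion ℚ)).toAffine.Point →+ _).ker = 1) := fun h ↦
      hvT (Finset.mem_union_right _ (Finset.mem_filter.mpr ⟨hv, h⟩))
    rcases hplaces v hv hvT0 with h1 | ⟨hWv, hW'v, hcard⟩ | ⟨hWv, hW'v, hγ', hμ⟩ |
        ⟨ℓ, hℓ, hℓ2, hℓv, hpv, hmult, hγ', hAv⟩
    · exact absurd h1 hnot1
    · exact A.h1Equiv_mem_selmerLocalKer_of_hasSplitMultiplicativeReductionAt v hU W θ hθ hWv hW'v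
        hcard hc
    · exact A.h1Equiv_mem_selmerLocalKer_of_hasMultiplicativeReductionAt v hU2 hp2 W θ hθ hWv hW'v
        hγ' hμ hc
    · haveI := hℓ
      exact h1Equiv_mem_selmerLocalKer_of_nonsplit_of_good_rat W A p hU2 hp2 θ hθ hℓ2 hℓv hmult hγ'
        hAv hpv hc

/-- **Shape A with four kinds (route (3e) over `ℚ`)**: `BSD(A,p) ⟹ BSD(E,p)` at a rank-`0` pair
`(E, p)` (`p` odd, `E[p]` irreducible, `p ∤ #Ш_an`) from a CLOSED partner `A` of analytic rank `0`
with `p ∤ #Ш(A)_an`, when `E(ℚ_p)[p] = 0` (the place of `p` is the only lossy place) and every bad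
place away from `p` is of kind (i), (ii), (iii) or (iv) — (iv): an odd prime `ℓ` where `E` is
non-split multiplicative and `A` good (the `19 + 6` budget-`9` cells of the `p = 3` census).
Binders GZK, Cassels–Tate, A40/A41. Not a class theorem; nothing booked.
[cite: MazurRubin2004, §2.3] [cite: Miller2011LMS, §1 and Def. 1.1]
[cite: SilvermanATAEC1994, Ch. V Thm. 3.1, Lemma 5.2, Thm. 5.3, Cor. 5.4] -/
theorem bsdp_of_bsdp_partner_of_selmerCompanion_lossy_at_p_of_kinds
    (hU : Silverman1994_thmV53_tateUniformisation.{0})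
    (hU2 : Silverman1994_thmV53_corV54_tateUniformisation.{0})
    (hGZK : rank_eq_analyticRank_of_analyticRank_le_one)
    (hCT : exists_casselsTate_pairing (K := ℚ)) (hp2 : p ≠ 2)
    (hr : W.analyticRank = 0) (hirr : Irr W p) (hSha : X11a.ShaAnUnit W p)
    (hbsdA : BSDp A p) (hShaA : X11a.ShaAnUnit A p) (hrA : A.analyticRank = 0)
    (e : geomTorsion A (p : ℤ) ≃+ geomTorsion W (p : ℤ))
    (he : ∀ (σ : absoluteGaloisGroup ℚ) (P : geomTorsion A (p : ℤ)), e (σ • P) = σ • e P)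
    (S : Finset (HeightOneSpectrum (𝓞 ℚ)))
    (hS : ∀ v : HeightOneSpectrum (𝓞 ℚ), v ∉ S →
      A.HasGoodReductionAt v ∧ W.HasGoodReductionAt v ∧ (p : 𝓞 ℚ) ∉ v.asIdeal)
    (hat : ∀ v ∈ S, (p : 𝓞 ℚ) ∈ v.asIdeal → Nat.card (nsmulAddMonoidHom p :
        (W.baseChange (v.adicCompletion ℚ)).toAffine.Point →+ _).ker = 1)
    (haway : ∀ v ∈ S, (p : 𝓞 ℚ) ∉ v.asIdeal →
      Nat.card (nsmulAddMonoidHom p :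
          (W.baseChange (v.adicCompletion ℚ)).toAffine.Point →+ _).ker = 1 ∨
      (A.HasSplitMultiplicativeReductionAt v ∧ W.HasSplitMultiplicativeReductionAt v ∧
        Nat.card (nsmulAddMonoidHom p :
          (A.baseChange (v.adicCompletion ℚ)).toAffine.Point →+ _).ker ≤ p) ∨
      (A.HasMultiplicativeReductionAt v ∧ W.HasMultiplicativeReductionAt v ∧
        (∃ r : v.adicCompletion ℚ, algebraMap ℚ (v.adicCompletion ℚ) (-(A.c₄ / A.c₆)) =
          r ^ 2 * algebraMap ℚ (v.adicCompletion ℚ) (-(W.c₄ / W.c₆))) ∧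
        (∀ ζ : v.adicCompletion ℚ, ζ ^ p = 1 → ζ = 1)) ∨
      (∃ (ℓ : ℕ) (_ : Fact ℓ.Prime), ℓ ≠ 2 ∧ (ℓ : 𝓞 ℚ) ∈ v.asIdeal ∧
        W.HasMultiplicativeReductionAtPrime ℓ ∧
        (∀ r : v.adicCompletion ℚ, algebraMap ℚ (v.adicCompletion ℚ) (-(W.c₄ / W.c₆)) ≠ r ^ 2) ∧
        A.HasGoodReductionAt v)) :
    BSDp W p := by
  have hpp : p.Prime := hp.out
  classical
  -- irreducibility of `A[p]`, the partner's count, and the transport along `θ = e⁻¹`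
  have hθ : ∀ (σ : absoluteGaloisGroup ℚ) (Q : geomTorsion W (p : ℤ)),
      e.symm (σ • Q) = σ • e.symm Q := fun σ Q ↦ by
    apply e.injective
    rw [e.apply_symm_apply, he, e.apply_symm_apply]
  have hirrA : Irr A p := GreenbergVatsal2000.hasIrreducibleModPGaloisRep_of_torsionIso e.symm hθ hirr
  have hSelA := natCard_selmerGroup_eq_pow_of_bsdp A p hbsdA hShaA hirrA
  set T := S.filter (fun v ↦ (p : 𝓞 ℚ) ∈ v.asIdeal) with hT
  have hTS : T ⊆ S := Finset.filter_subset _ _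
  have hle := natCard_selmerGroup_le_of_congr_of_places_rat W A p hU hU2 hp2 e.symm hθ S T hTS hS
    (fun v hv hvT ↦ ?_)
  · refine bsdp_of_natCard_selmerGroup_le W p hGZK hCT hr hirr hSha (hle.trans ?_)
    have hprod : ∏ v ∈ T, (Nat.card (nsmulAddMonoidHom p :
          (W.baseChange (v.adicCompletion ℚ)).toAffine.Point →+ _).ker *
        Nat.card (v.adicCompletionIntegers ℚ ⧸ Ideal.span {(p : v.adicCompletionIntegers ℚ)})) =
        ∏ v ∈ T, Nat.card (v.adicCompletionIntegers ℚ ⧸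
          Ideal.span {(p : v.adicCompletionIntegers ℚ)}) := by
      refine Finset.prod_congr rfl fun v hv ↦ ?_
      rw [Finset.mem_filter] at hv
      rw [hat v hv.1 hv.2, one_mul]
    have hTout : ∀ v : HeightOneSpectrum (𝓞 ℚ), v ∉ T → (p : 𝓞 ℚ) ∉ v.asIdeal := by
      intro v hv hpv
      by_cases hvS : v ∈ S
      · exact hv (Finset.mem_filter.mpr ⟨hvS, hpv⟩)
      · exact (hS v hvS).2.2 hpv
    rw [hSelA, hrA, pow_zero, one_mul, hprod, prod_natCard_quot_adicCompletionIntegers T hTout,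
      Module.finrank_self, pow_one]
  · have hvp : (p : 𝓞 ℚ) ∉ v.asIdeal := fun h ↦ hvT (Finset.mem_filter.mpr ⟨hv, h⟩)
    rcases haway v hv hvp with h1 | h2 | h3 | ⟨ℓ, hℓ, hℓ2, hℓv, hmult, hγ', hAv⟩
    · exact Or.inl ⟨hvp, h1⟩
    · exact Or.inr (Or.inl h2)
    · exact Or.inr (Or.inr (Or.inl h3))
    · exact Or.inr (Or.inr (Or.inr ⟨ℓ, hℓ, hℓ2, hℓv, hvp, hmult, hγ', hAv⟩))

end Rat

end Summit.BirchSwinnertonDyer.Rank1Residual.X11a.SelmerCompanion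

end
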